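import Summits.BirchSwinnertonDyer.BirchSwinnertonDyer.Theorems.ByReductionTypeAtTwoRankOneAtTwoOneDoorLawFirstLayerDefs
import Literature.NumberTheory.EllipticCurves.HeegnerPointsRationalityProofs
import Literature.NumberTheory.EllipticCurves.BSDHeegnerPointsTorsionProofs
import HarnessLib

/-!
# Route ByReductionTypeAtTwo, crux `RankOneAtTwoBigImageOddLocal` (stmt-BirchSwinnertonDyer-23715), line `one_door_analytic`:
# DATUM COVARIANCE of the floating Heegner exponent — the stub R₀⁺ (`HeegnerExponentAtSelmerTrivialMinimalDoorAtTwo`, route item 23932) is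
# invariant under scaling the parametrisation datum

Lead prover seat `bsd-line-fkl-p1` g19 (2026-08-29).  THEOREMS ONLY (standard axioms; no `def`, no named fact, no `sorry`, nothing conditional).
Helper file `--supports stmt-BirchSwinnertonDyer-23715`; it does not close the crux and BSD is not proved by any of this.

WHY.  The line's load-bearing first-layer stub R₀⁺ (v8.17 `stub_heegnerExponent`; promoted to route item 23932 `RankOneHeegnerExponentFirstLayerAtTwo`,
pen RC-359) quantifies over EVERY parametrisation datum `Dt : ModularParametrizationData W N` and asserts that the Heegner point of `Dt` has exact
`2`-divisibility exponent `v₂(Dt.c)` modulo torsion.  `ModularParametrizationData` pins `c` only by `c·Λ_f ⊆ Λ_E` (REF1 §152 A4: the doubled datum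
`(f, L, uniformize, 2c, 4·deg)` is again a datum and doubles every Heegner point — the junk mutation that killed ES-24c/ES-24t as typed; cdisprove g0 on
23932, `Disproof.lean` F2: «datum covariance — scalar-scaling attacks fail», in words).  This file is the kernel form of that covariance:

* §1 exponent arithmetic in `E(K)` modulo torsion: `hasTwoDivisibilityUpToTorsion_neg_iff`, `…_nsmul_odd_iff` (an ODD multiple has the SAME exponent —
  Bezout modulo `2^{m+1}`), `…_two_nsmul_succ_iff` / `…_two_pow_nsmul_iff` (a `2^v`-multiple shifts the exponent by `v`), `…_zsmul_iff`
  (`k • P`, `k ≠ 0`: shift by `v₂(k)`);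
* §2 data: if two data `Dt₁`, `Dt₂` of the same `W` and level have `Dt₂.c = k·Dt₁.c` and `φ_{Dt₂} = k • φ_{Dt₁}` on Heegner points (`k ≠ 0`), then at
  every door field the conclusion of R₀⁺ for `Dt₂` is EQUIVALENT to the conclusion for `Dt₁` (`heegnerExponent_conclusion_iff_of_scaled`), the
  `K`-rational Heegner point being supplied by the tree theorem `heegnerPointComplex_mem_range_map_holds` (Darmon 2004 Thm. 3.6).
So R₀⁺ can neither be refuted nor be made easier by rescaling a datum; its content sits at ONE datum per curve and level (e.g. a primitive one).
What is NOT here: the construction of the scaled datum `k • Dt` itself (its `deg_spec` needs `#E(ℂ)[k] = k²` on `Y₀(N)`-fibres — REF1 §152 took it as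
the hypothesis `DoubledDegSpec`), and any claim that R₀⁺ at a primitive datum follows from the proved bottom rung U₀ (it does not: U₀ is `m = 0 ⟹
Sel₂`-trivial twin, R₀⁺/R₀ is the converse — Kolyvagin's conjecture at `2`; see the lead report G19 §3 on the 23932 idea cards).
-/

set_option autoImplicit false
set_option linter.dupNamespace false

noncomputable section

open scoped Classical

namespace Summit.BirchSwinnertonDyer.BirchSwinnertonDyer.Theorems.RankOneAtTwoOneDoor

open WeierstrassCurve NumberField
open Literature.NumberTheory.EllipticCurves Literature.NumberTheory.EllipticCurves.ModularForms
open Summit.BirchSwinnertonDyer.Rank1Residual.F1Sign2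

/-! ## §1 Exponent arithmetic modulo torsion -/

section Exponent

variable (W : WeierstrassCurve ℚ) (K : Type) [Field K] [NumberField K]

/-- If `n • x` is torsion for some `n ≠ 0` then `x` is torsion. [folklore] -/
theorem mem_torsion_of_nsmul_mem_torsion {A : Type*} [AddCommGroup A] {n : ℕ} (hn : n ≠ 0) {x : A}
    (h : n • x ∈ AddCommGroup.torsion A) : x ∈ AddCommGroup.torsion A := by
  rw [AddCommGroup.mem_torsion] at h ⊢
  obtain ⟨k, hk, hkx⟩ := (isOfFinAddOrder_iff_nsmul_eq_zero).mp h
  exact (isOfFinAddOrder_iff_nsmul_eq_zero).mpr ⟨k * n, Nat.mul_pos hk (Nat.pos_of_ne_zero hn), by rw [mul_nsmul', hkx]⟩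

/-- `−P ∉ 2E(K) + E(K)_tors ⟺ P ∉ 2E(K) + E(K)_tors`. [folklore] -/
theorem notTwiceUpToTorsion_neg_iff (P : (W.baseChange K).toAffine.Point) :
    NotTwiceUpToTorsion W K (-P) ↔ NotTwiceUpToTorsion W K P := by
  constructor
  · rintro h ⟨R, hR⟩
    refine h ⟨-R, ?_⟩
    have e : -P - 2 • (-R) = -(P - 2 • R) := by module
    rw [e]
    exact neg_mem hR
  · rintro h ⟨R, hR⟩
    refine h ⟨-R, ?_⟩
    have e : P - 2 • (-R) = -(-P - 2 • R) := by module
    rw [e]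
    exact neg_mem hR

/-- `−P` has the same exact exponent as `P`. [folklore] -/
theorem hasTwoDivisibilityUpToTorsion_neg_iff (P : (W.baseChange K).toAffine.Point) (m : ℕ) :
    HasTwoDivisibilityUpToTorsion W K (-P) m ↔ HasTwoDivisibilityUpToTorsion W K P m := by
  constructor
  · rintro ⟨Q, hQ, hnt⟩
    refine ⟨-Q, ?_, (notTwiceUpToTorsion_neg_iff W K Q).mpr hnt⟩
    have e : P - 2 ^ m • (-Q) = -(-P - 2 ^ m • Q) := by module
    rw [e]
    exact neg_mem hQ
  · rintro ⟨Q, hQ, hnt⟩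
    refine ⟨-Q, ?_, (notTwiceUpToTorsion_neg_iff W K Q).mpr hnt⟩
    have e : -P - 2 ^ m • (-Q) = -(P - 2 ^ m • Q) := by module
    rw [e]
    exact neg_mem hQ

/-- Bezout modulo a power of two: for odd `k` and every `m` there are `a, b : ℕ` with `k·a = b·2^{m+1} + 1` (and then `a` is odd). [folklore] -/
theorem exists_mul_eq_mul_two_pow_succ_add_one {k : ℕ} (hk : Odd k) (m : ℕ) : ∃ a b : ℕ, Odd a ∧ k * a = b * 2 ^ (m + 1) + 1 := by
  have hcop : Nat.Coprime k (2 ^ (m + 1)) := Nat.Coprime.pow_right _ hk.coprime_two_right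
  have h1 : 1 < 2 ^ (m + 1) := Nat.one_lt_two_pow (Nat.succ_ne_zero m)
  obtain ⟨a, -, ha⟩ := Nat.exists_mul_mod_eq_one_of_coprime hcop h1
  refine ⟨a, k * a / 2 ^ (m + 1), ?_, ?_⟩
  · -- `a` is odd: `k a ≡ 1 (mod 2)`
    rw [← Nat.not_even_iff_odd]
    rintro ⟨a', rfl⟩
    have h2 : (k * (a' + a')) % 2 ^ (m + 1) % 2 = 1 % 2 := by rw [ha]
    rw [Nat.mod_mod_of_dvd _ (dvd_pow_self 2 (Nat.succ_ne_zero m)), show k * (a' + a') = 2 * (k * a') by ring,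
      Nat.mul_mod_right] at h2
    norm_num at h2
  · have := Nat.div_add_mod (k * a) (2 ^ (m + 1))
    rw [ha] at this
    linarith [this, Nat.mul_comm (2 ^ (m + 1)) (k * a / 2 ^ (m + 1))]

/-- **An ODD multiple is `2`-indivisible modulo torsion iff the point is.** [folklore] -/
theorem notTwiceUpToTorsion_nsmul_odd_iff {k : ℕ} (hk : Odd k) (P : (W.baseChange K).toAffine.Point) :
    NotTwiceUpToTorsion W K (k • P) ↔ NotTwiceUpToTorsion W K P := by
  obtain ⟨a, b, -, hab⟩ := exists_mul_eq_mul_two_pow_succ_add_one hk 0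
  rw [zero_add, pow_one] at hab
  constructor
  · rintro h ⟨R, hR⟩
    -- `P − 2R ∈ tors ⟹ kP − 2(kR) = k(P − 2R) ∈ tors`
    refine h ⟨k • R, ?_⟩
    have e : k • P - 2 • (k • R) = k • (P - 2 • R) := by module
    rw [e]
    exact AddSubgroup.nsmul_mem _ hR k
  · rintro h ⟨R, hR⟩
    -- `kP − 2R = t ∈ tors`; `k a = 2 b + 1`: `P = a(kP) − 2b P = 2(aR − bP) + a t`
    refine h ⟨a • R - b • P, ?_⟩
    have e : P - 2 • (a • R - b • P) = a • (k • P - 2 • R) + (2 * b + 1) • P - (k * a) • P := by module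
    rw [e, hab, Nat.mul_comm b 2, add_sub_cancel_right]
    exact AddSubgroup.nsmul_mem _ hR a

/-- **An ODD multiple has the SAME exact exponent** (`HasTwoDivisibilityUpToTorsion W K (k • P) m ↔ HasTwoDivisibilityUpToTorsion W K P m` for odd `k`).
[folklore] -/
theorem hasTwoDivisibilityUpToTorsion_nsmul_odd_iff {k : ℕ} (hk : Odd k) (P : (W.baseChange K).toAffine.Point) (m : ℕ) :
    HasTwoDivisibilityUpToTorsion W K (k • P) m ↔ HasTwoDivisibilityUpToTorsion W K P m := by
  constructor
  · rintro ⟨Q, hQ, hnt⟩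
    -- `kP − 2^m Q = t`; Bezout `k a = b 2^{m+1} + 1`: `P = 2^m (aQ − 2bP) + a t`
    obtain ⟨a, b, ha, hab⟩ := exists_mul_eq_mul_two_pow_succ_add_one hk m
    refine ⟨a • Q - (2 * b) • P, ?_, ?_⟩
    · have e : P - 2 ^ m • (a • Q - (2 * b) • P) = a • (k • P - 2 ^ m • Q) + (b * 2 ^ (m + 1) + 1) • P - (k * a) • P := by
        rw [pow_succ]
        module
      rw [e, hab, add_sub_cancel_right]
      exact AddSubgroup.nsmul_mem _ hQ a
    · -- `aQ − 2bP ∉ 2E + tors` since `a` is odd and `Q ∉ 2E + tors`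
      rintro ⟨R, hR⟩
      obtain ⟨a', rfl⟩ := ha
      apply hnt
      refine ⟨R + b • P - a' • Q, ?_⟩
      have e : Q - 2 • (R + b • P - a' • Q) = (2 * a' + 1) • Q - (2 * b) • P - 2 • R := by module
      rw [e]
      exact hR
  · rintro ⟨Q, hQ, hnt⟩
    refine ⟨k • Q, ?_, (notTwiceUpToTorsion_nsmul_odd_iff W K hk Q).mpr hnt⟩
    have e : k • P - 2 ^ m • (k • Q) = k • (P - 2 ^ m • Q) := by module
    rw [e]
    exact AddSubgroup.nsmul_mem _ hQ k

/-- **Doubling raises the exact exponent by one, and conversely** (`2 • P` has exponent `m + 1` iff `P` has exponent `m`). [folklore] -/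
theorem hasTwoDivisibilityUpToTorsion_two_nsmul_succ_iff (P : (W.baseChange K).toAffine.Point) (m : ℕ) :
    HasTwoDivisibilityUpToTorsion W K (2 • P) (m + 1) ↔ HasTwoDivisibilityUpToTorsion W K P m := by
  have e : ∀ Q : (W.baseChange K).toAffine.Point, 2 • P - 2 ^ (m + 1) • Q = 2 • (P - 2 ^ m • Q) := fun Q => by
    rw [pow_succ]
    module
  constructor
  · rintro ⟨Q, hQ, hnt⟩
    refine ⟨Q, mem_torsion_of_nsmul_mem_torsion two_ne_zero ?_, hnt⟩
    rwa [← e]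
  · rintro ⟨Q, hQ, hnt⟩
    refine ⟨Q, ?_, hnt⟩
    rw [e]
    exact AddSubgroup.nsmul_mem _ hQ 2

/-- **A `2^v`-multiple shifts the exact exponent by `v`.** [folklore] -/
theorem hasTwoDivisibilityUpToTorsion_two_pow_nsmul_iff (P : (W.baseChange K).toAffine.Point) (m v : ℕ) :
    HasTwoDivisibilityUpToTorsion W K (2 ^ v • P) (m + v) ↔ HasTwoDivisibilityUpToTorsion W K P m := by
  induction v with
  | zero => rw [pow_zero, one_smul, add_zero]
  | succ v ih => rw [pow_succ', ← smul_smul, ← add_assoc, hasTwoDivisibilityUpToTorsion_two_nsmul_succ_iff, ih]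

/-- **A nonzero natural multiple `n • P` shifts the exact exponent by `v₂(n)`.** [folklore] -/
theorem hasTwoDivisibilityUpToTorsion_nsmul_iff {n : ℕ} (hn : n ≠ 0) (P : (W.baseChange K).toAffine.Point) (m : ℕ) :
    HasTwoDivisibilityUpToTorsion W K (n • P) (m + padicValNat 2 n) ↔ HasTwoDivisibilityUpToTorsion W K P m := by
  obtain ⟨v, n', hn', rfl⟩ := Nat.exists_eq_two_pow_mul_odd hn
  have h2n' : ¬ 2 ∣ n' := fun h => (Nat.not_even_iff_odd.mpr hn') (even_iff_two_dvd.mpr h)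
  rw [padicValNat.mul (pow_ne_zero _ two_ne_zero) hn'.pos.ne', padicValNat.prime_pow, padicValNat.eq_zero_of_not_dvd h2n', add_zero,
    mul_comm, mul_smul, hasTwoDivisibilityUpToTorsion_nsmul_odd_iff W K hn', hasTwoDivisibilityUpToTorsion_two_pow_nsmul_iff]

/-- **A nonzero integer multiple `k • P` shifts the exact exponent by `v₂(k)`.** [folklore] -/
theorem hasTwoDivisibilityUpToTorsion_zsmul_iff {k : ℤ} (hk : k ≠ 0) (P : (W.baseChange K).toAffine.Point) (m : ℕ) :
    HasTwoDivisibilityUpToTorsion W K (k • P) (m + padicValInt 2 k) ↔ HasTwoDivisibilityUpToTorsion W K P m := by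
  have hn0 : k.natAbs ≠ 0 := Int.natAbs_ne_zero.mpr hk
  have key := hasTwoDivisibilityUpToTorsion_nsmul_iff W K hn0 P m
  rcases Int.natAbs_eq k with h | h
  · have e : k • P = k.natAbs • P := by rw [← natCast_zsmul, ← h]
    rw [e]
    exact key
  · have e : k • P = -(k.natAbs • P) := by rw [← natCast_zsmul, ← neg_smul, ← h]
    rw [e, hasTwoDivisibilityUpToTorsion_neg_iff]
    exact key

end Exponent

/-! ## §2 Data: the conclusion of R₀⁺ is invariant under scaling the datum -/

section Data

variable {W : WeierstrassCurve ℚ} [W.IsElliptic] {N : ℕ} [NeZero N] {K : Type} [Field K] [NumberField K]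

omit [W.IsElliptic] [NeZero N] in
/-- Two `K`-points whose complex images are `k`-proportional are `k`-proportional (`E(K) → E(ℂ)` is an injective homomorphism). [folklore] -/
theorem eq_zsmul_of_map_eq_zsmul_map (ι : K →+* ℂ) (k : ℤ) (P₁ P₂ : (W.baseChange K).toAffine.Point)
    (h : WeierstrassCurve.Affine.Point.map ι.toRatAlgHom P₂ = k • WeierstrassCurve.Affine.Point.map ι.toRatAlgHom P₁) :
    P₂ = k • P₁ :=
  WeierstrassCurve.Affine.Point.map_injective _ (by rw [h, map_zsmul])

omit [W.IsElliptic] in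
/-- **The conclusion of R₀⁺ at two proportional data is ONE statement.**  If `Dt₂.c = k·Dt₁.c` and the Heegner point of `Dt₂` at `H` is `k •` that of
`Dt₁` (`k ≠ 0`), then for the `K`-rational door points `P₁`, `P₂` of the two data: `P₂` has exact exponent `v₂(Dt₂.c)` iff `P₁` has exact exponent
`v₂(Dt₁.c)` — `P₂ = k • P₁`, `v₂(k c₁) = v₂(k) + v₂(c₁)` (`c₁ ≠ 0`, `maninConstant_ne_zero_holds`) and §1. [folklore] -/
theorem hasTwoDivisibilityUpToTorsion_padicValInt_iff_of_scaled (Dt₁ Dt₂ : ModularParametrizationData W N) {k : ℤ} (hk : k ≠ 0)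
    (hc : Dt₂.c = k * Dt₁.c) {D : ℤ} (H : HeegnerDatum N D) (hH : heegnerPointComplex Dt₂ H = k • heegnerPointComplex Dt₁ H)
    (ι : K →+* ℂ) (P₁ P₂ : (W.baseChange K).toAffine.Point)
    (h₁ : WeierstrassCurve.Affine.Point.map ι.toRatAlgHom P₁ = heegnerPointComplex Dt₁ H)
    (h₂ : WeierstrassCurve.Affine.Point.map ι.toRatAlgHom P₂ = heegnerPointComplex Dt₂ H) :
    HasTwoDivisibilityUpToTorsion W K P₂ (padicValInt 2 Dt₂.c) ↔ HasTwoDivisibilityUpToTorsion W K P₁ (padicValInt 2 Dt₁.c) := by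
  have hP : P₂ = k • P₁ := eq_zsmul_of_map_eq_zsmul_map ι k P₁ P₂ (by rw [h₂, hH, h₁])
  have hc₁ : Dt₁.c ≠ 0 := Dt₁.maninConstant_ne_zero_holds
  rw [hP, hc, padicValInt.mul hk hc₁, add_comm]
  exact hasTwoDivisibilityUpToTorsion_zsmul_iff W K hk P₁ _

/-- **DATUM COVARIANCE OF R₀⁺.**  For an imaginary quadratic `K` satisfying the Heegner hypothesis for `N` (so that every datum HAS a `K`-rational
Heegner point: `heegnerPointComplex_mem_range_map_holds`, Darmon 2004 Thm. 3.6) and two data `Dt₁`, `Dt₂` of `W` at level `N` with `Dt₂.c = k·Dt₁.c`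
and `φ_{Dt₂} = k • φ_{Dt₁}` on Heegner points of discriminant `d_K` (`k ≠ 0`): the conclusion of `HeegnerExponentAtSelmerTrivialMinimalDoorAtTwo`
(«every `K`-rational door point has exact exponent `v₂(c)`») holds for `Dt₂` IFF it holds for `Dt₁`.  In particular rescaling a datum (REF1 §152 A4's
doubling, or any `k`) can neither refute R₀⁺ nor prove it. [cite: Darmon2004, Thm. 3.6] -/
theorem heegnerExponent_conclusion_iff_of_scaled (hK : IsImaginaryQuadratic K) (hHN : SatisfiesHeegnerHypothesis N K)
    (Dt₁ Dt₂ : ModularParametrizationData W N) {k : ℤ} (hk : k ≠ 0) (hc : Dt₂.c = k * Dt₁.c)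
    (hH : ∀ H : HeegnerDatum N (NumberField.discr K), heegnerPointComplex Dt₂ H = k • heegnerPointComplex Dt₁ H) :
    (∀ (H : HeegnerDatum N (NumberField.discr K)) (ι : K →+* ℂ) (P : (W.baseChange K).toAffine.Point),
      WeierstrassCurve.Affine.Point.map ι.toRatAlgHom P = heegnerPointComplex Dt₂ H →
        HasTwoDivisibilityUpToTorsion W K P (padicValInt 2 Dt₂.c)) ↔
    (∀ (H : HeegnerDatum N (NumberField.discr K)) (ι : K →+* ℂ) (P : (W.baseChange K).toAffine.Point),
      WeierstrassCurve.Affine.Point.map ι.toRatAlgHom P = heegnerPointComplex Dt₁ H →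
        HasTwoDivisibilityUpToTorsion W K P (padicValInt 2 Dt₁.c)) := by
  constructor
  · intro h₂ H ι P₁ hP₁
    obtain ⟨P₂, hP₂⟩ := heegnerPointComplex_mem_range_map_holds N W K hK hHN Dt₂ H ι
    exact (hasTwoDivisibilityUpToTorsion_padicValInt_iff_of_scaled Dt₁ Dt₂ hk hc H (hH H) ι P₁ P₂ hP₁ hP₂).mp (h₂ H ι P₂ hP₂)
  · intro h₁ H ι P₂ hP₂
    obtain ⟨P₁, hP₁⟩ := heegnerPointComplex_mem_range_map_holds N W K hK hHN Dt₁ H ι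
    exact (hasTwoDivisibilityUpToTorsion_padicValInt_iff_of_scaled Dt₁ Dt₂ hk hc H (hH H) ι P₁ P₂ hP₁ hP₂).mpr (h₁ H ι P₁ hP₁)

end Data

end Summit.BirchSwinnertonDyer.BirchSwinnertonDyer.Theorems.RankOneAtTwoOneDoor

end
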